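import Summits.CriticalPhenomena.PercolationContinuityZ3.Theorems.Transplant.Slab111HubAtt
import HarnessLib

/-!
# The HUB ROUTING of the `(111)`-films, I: the data of one hub routing (`HubData`) and its derived pieces

builds on p205010 (kernel theorem, internal audit signed; external expert review pending) — NOT used in this file.  Lane `prim-bschramm`, seat
`prim-bschramm-p2` (gen 36; class C1b; memo `HOME/bschramm/P2-LATTICES.md` §130); helper file (`--supports stmt-CriticalPhenomena-4575 --as helper`).

THE GENERIC CONSTRUCTION of the gen-36 design for `HexShadow.ShapedLinkage 3 (Slab111.hexShadow k)` («HexShadowVRouteData»).  Data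
(`HubData`): a hub column `z` (class `c0`); three pairwise column-disjoint annulus faces `F₁, F₂, F₃` of the hub («Slab111VRide».`FaceD`), each
attached to the hub (`Att Fᵢ dᵢ`: class-`1` column a unit of `U`, `dᵢ = 1`, or class-`2` column a unit of `−U`, `dᵢ = −1`); two consecutive hub
vertices `H_A = (z, L_A)`, `H_D = (z, L_D)`, `L_D = L_A + 3τ`; terminals `E₁, E₂, w'` joined by LEGS to ride vertices `e₁ ∈ F₁`, `e₂ ∈ F₂`, `e₃ ∈ F₃`,
`e₁` before `c = att(F₁, H_A)` in the direction `τ`; level WINDOWS of the faces inside the regions `PR ⊆ W`; `Clear`/hub/membership conditions on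
the leg vertices.  From it («Slab111HubRoute1/2»): routing 1 `P₁ = leg₁ · F₁[e₁ → c → y → d] · H_D · F₂[att → e₂] · leg₂`, branch `H_A · F₃ · leg₃`,
and routing 2 `P₂ = leg₁ · F₁[e₁ → c] · H_A · F₂ · leg₂`, branch `y · F₁[y → d] · H_D · F₃ · leg₃` — a SWAP PAIR (`y₁ = b₂`, `b₁ = y₂`).
* §2 `HubData` and the named pieces (`e₁ e₂ e₃ c d y HA HD`, the segments `S1 S1c Syd`, `S2 L`, `S3 L`);
* §3 the shared facts: segments are paths inside the regions, `Clear`-exclusion, hubs off segments, legs off the pieces.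
[cite: DuminilCopinSidoraviciusTassion2016, §2.3 (proof of Fact 2: the three disjoint paths γ_u, γ_v, γ_w in B_R(z))]
-/

noncomputable section

namespace Summit.CriticalPhenomena.PercolationContinuityZ3.Theorems.Transplant

open Literature.Probability.Percolation Literature.Probability.LatticeModels SimpleGraph
open scoped Classical

namespace Slab111

variable {k : ℕ} {z : Site 2} {c0 : ℤ}

/-! ## §2 The data of a hub routing -/

/-- **The data and hypotheses of one hub routing** (see the file header).  `W ⊇ PR` are the cleared set and the rerouting region; the faces
`F1, F2, F3` carry `E₁, E₂, w'` (via the legs); `LA, LD` are the two hub levels; `ℓᵢ` the levels of the leg ends `eᵢ`; `m₁` the number of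
steps from `e₁` to `c`. [cite: DuminilCopinSidoraviciusTassion2016, §2.3 (proof of Fact 2: γ_u, γ_v, γ_w)] -/
structure HubData (k : ℕ) (z : Site 2) (c0 : ℤ) (W PR : Set (slab111 k)) (E₁ E₂ w' : slab111 k) where
  /-- faces of `E₁`, `E₂`, `w'` -/
  (F1 F2 F3 : FaceD)
  /-- attachment directions -/
  (d₁ d₂ d₃ : ℤ)
  /-- hub levels and the direction from `H_A` to `H_D` -/
  (LA LD τ : ℤ)
  /-- levels of the leg ends -/
  (ℓ₁ ℓ₂ ℓ₃ : ℤ)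
  /-- steps from `e₁` to `c` -/
  (m₁ : ℕ)
  /-- the legs -/
  (leg₁ leg₂ leg₃ : List (slab111 k))
  hz : (3 : ℤ) ∣ z 0 + 2 * z 1 - c0
  hPRW : PR ⊆ W
  hF1 : F1.ok
  hF2 : F2.ok
  hF3 : F3.ok
  ho1 : F1.OffHub
  ho2 : F2.OffHub
  ho3 : F3.OffHub
  h12 : F1.Disj F2
  h13 : F1.Disj F3
  h23 : F2.Disj F3
  hA1 : Att F1 d₁
  hA2 : Att F2 d₂
  hA3 : Att F3 d₃
  hτ : τ = 1 ∨ τ = -1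
  hLD : LD = LA + 3 * τ
  hLA : (3 : ℤ) ∣ LA - c0
  hLA1 : 1 ≤ LA
  hLAk : LA + 1 ≤ k
  hLD1 : 1 ≤ LD
  hLDk : LD + 1 ≤ k
  hne : E₁ ≠ E₂
  hℓ₁ : 0 ≤ ℓ₁ ∧ ℓ₁ ≤ k
  hℓ₂ : 0 ≤ ℓ₂ ∧ ℓ₂ ≤ k
  hℓ₃ : 0 ≤ ℓ₃ ∧ ℓ₃ ≤ k
  hm₁ : ℓ₁ + τ * (m₁ : ℤ) = LA + d₁
  hW1 : ∀ L : ℤ, min ℓ₁ (min LA LD - 1) ≤ L → L ≤ max ℓ₁ (max LA LD + 1) → rideV k z c0 F1 L ∈ PR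
  hW2 : ∀ L : ℤ, min ℓ₂ (min LA LD - 1) ≤ L → L ≤ max ℓ₂ (max LA LD + 1) → rideV k z c0 F2 L ∈ PR
  hW3 : ∀ L : ℤ, min ℓ₃ (min LA LD - 1) ≤ L → L ≤ max ℓ₃ (max LA LD + 1) → rideV k z c0 F3 L ∈ W
  hHA : hubV k z LA ∈ PR
  hHD : hubV k z LD ∈ PR
  hl1 : GPath (film k) leg₁ E₁ (rideV k z c0 F1 ℓ₁)
  hl2 : GPath (film k) leg₂ (rideV k z c0 F2 ℓ₂) E₂
  hl3 : GPath (film k) leg₃ (rideV k z c0 F3 ℓ₃) w'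
  hL1 : ∀ v ∈ leg₁, v ≠ rideV k z c0 F1 ℓ₁ →
    Clear z F1 (min ℓ₁ (min LA LD - 1)) (max ℓ₁ (max LA LD + 1)) v ∧ Clear z F2 (min ℓ₂ (min LA LD - 1)) (max ℓ₂ (max LA LD + 1)) v ∧
    Clear z F3 (min ℓ₃ (min LA LD - 1)) (max ℓ₃ (max LA LD + 1)) v ∧ (sh v ≠ vcol z (0, 0) ∨ (lev (v : Site 3) ≠ LA ∧ lev (v : Site 3) ≠ LD)) ∧
    (v ≠ E₁ → v ∈ PR)
  hL2 : ∀ v ∈ leg₂, v ≠ rideV k z c0 F2 ℓ₂ →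
    Clear z F1 (min ℓ₁ (min LA LD - 1)) (max ℓ₁ (max LA LD + 1)) v ∧ Clear z F2 (min ℓ₂ (min LA LD - 1)) (max ℓ₂ (max LA LD + 1)) v ∧
    Clear z F3 (min ℓ₃ (min LA LD - 1)) (max ℓ₃ (max LA LD + 1)) v ∧ (sh v ≠ vcol z (0, 0) ∨ (lev (v : Site 3) ≠ LA ∧ lev (v : Site 3) ≠ LD)) ∧
    (v ≠ E₂ → v ∈ PR)
  hL3 : ∀ v ∈ leg₃, v ≠ rideV k z c0 F3 ℓ₃ →
    Clear z F1 (min ℓ₁ (min LA LD - 1)) (max ℓ₁ (max LA LD + 1)) v ∧ Clear z F2 (min ℓ₂ (min LA LD - 1)) (max ℓ₂ (max LA LD + 1)) v ∧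
    Clear z F3 (min ℓ₃ (min LA LD - 1)) (max ℓ₃ (max LA LD + 1)) v ∧ (sh v ≠ vcol z (0, 0) ∨ (lev (v : Site 3) ≠ LA ∧ lev (v : Site 3) ≠ LD)) ∧
    v ∈ W
  hL12 : ∀ v ∈ leg₁, v ≠ rideV k z c0 F1 ℓ₁ → ∀ u ∈ leg₂, u ≠ rideV k z c0 F2 ℓ₂ → v ≠ u
  hL13 : ∀ v ∈ leg₁, v ≠ rideV k z c0 F1 ℓ₁ → ∀ u ∈ leg₃, u ≠ rideV k z c0 F3 ℓ₃ → v ≠ u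
  hL23 : ∀ v ∈ leg₂, v ≠ rideV k z c0 F2 ℓ₂ → ∀ u ∈ leg₃, u ≠ rideV k z c0 F3 ℓ₃ → v ≠ u

namespace HubData

variable {W PR : Set (slab111 k)} {E₁ E₂ w' : slab111 k} (D : HubData k z c0 W PR E₁ E₂ w')

/-- The leg end `e₁` on `F1`. [folklore] -/
def e₁ : slab111 k := rideV k z c0 D.F1 D.ℓ₁
/-- The leg end `e₂` on `F2`. [folklore] -/
def e₂ : slab111 k := rideV k z c0 D.F2 D.ℓ₂
/-- The leg end `e₃` on `F3`. [folklore] -/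
def e₃ : slab111 k := rideV k z c0 D.F3 D.ℓ₃
/-- The gadget vertex `c = att(F1, H_A)`. [folklore] -/
def c : slab111 k := rideV k z c0 D.F1 (D.LA + D.d₁)
/-- The vertex `d = att(F1, H_D)`. [folklore] -/
def d : slab111 k := rideV k z c0 D.F1 (D.LD + D.d₁)
/-- The successor `y` of `c` towards `d`. [folklore] -/
def y : slab111 k := rideV k z c0 D.F1 (D.LA + D.d₁ + D.τ)
/-- The hub `H_A`. [folklore] -/
def HA : slab111 k := hubV k z D.LA
/-- The hub `H_D`. [folklore] -/
def HD : slab111 k := hubV k z D.LD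
/-- The `F1`-segment `e₁ → d`. [folklore] -/
def S1 : List (slab111 k) := segL k z c0 D.F1 D.ℓ₁ D.τ (D.m₁ + 3)
/-- The `F1`-segment `e₁ → c`. [folklore] -/
def S1c : List (slab111 k) := segL k z c0 D.F1 D.ℓ₁ D.τ D.m₁
/-- The `F1`-segment `y → d`. [folklore] -/
def Syd : List (slab111 k) := segL k z c0 D.F1 (D.LA + D.d₁ + D.τ) D.τ 2
/-- The `F2`-segment from the attachment of the hub of level `L` to `e₂`. [folklore] -/
def S2 (L : ℤ) : List (slab111 k) := segL k z c0 D.F2 (L + D.d₂) (dirOf (L + D.d₂) D.ℓ₂) (lenOf (L + D.d₂) D.ℓ₂)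
/-- The `F3`-segment from the attachment of the hub of level `L` to `e₃`. [folklore] -/
def S3 (L : ℤ) : List (slab111 k) := segL k z c0 D.F3 (L + D.d₃) (dirOf (L + D.d₃) D.ℓ₃) (lenOf (L + D.d₃) D.ℓ₃)

/-! ## §3 Shared facts -/

/-- `d₁ = ±1`. [folklore] -/
theorem hd1 : D.d₁ = 1 ∨ D.d₁ = -1 := D.hA1.dir_eq
/-- `d₂ = ±1`. [folklore] -/
theorem hd2 : D.d₂ = 1 ∨ D.d₂ = -1 := D.hA2.dir_eq
/-- `d₃ = ±1`. [folklore] -/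
theorem hd3 : D.d₃ = 1 ∨ D.d₃ = -1 := D.hA3.dir_eq

/-- `LD ≡ c0`. [folklore] -/
theorem hLDc : (3 : ℤ) ∣ D.LD - c0 := by
  have : D.LD - c0 = (D.LA - c0) + 3 * D.τ := by rw [D.hLD]; ring
  rw [this]; exact dvd_add D.hLA (dvd_mul_right 3 _)

/-- A hub level is one of `LA, LD`. [folklore] -/
def IsHub (L : ℤ) : Prop := L = D.LA ∨ L = D.LD

/-- Facts about a hub level. [folklore] -/
theorem hub_facts {L : ℤ} (hL : D.IsHub L) : (3 : ℤ) ∣ L - c0 ∧ 1 ≤ L ∧ L + 1 ≤ k ∧ min D.LA D.LD - 1 ≤ L - 1 ∧ L + 1 ≤ max D.LA D.LD + 1 := by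
  rcases hL with rfl | rfl
  · exact ⟨D.hLA, D.hLA1, D.hLAk, by omega, by omega⟩
  · exact ⟨D.hLDc, D.hLD1, D.hLDk, by omega, by omega⟩

/-- Shadow of a hub vertex. [folklore] -/
theorem sh_hub {L : ℤ} (hL : D.IsHub L) : sh (hubV k z L) = vcol z (0, 0) :=
  sh_hubV D.hz (D.hub_facts hL).1 (by have := (D.hub_facts hL).2.1; omega) (by have := (D.hub_facts hL).2.2.1; omega)

/-- Level of a hub vertex. [folklore] -/
theorem lev_hub {L : ℤ} (hL : D.IsHub L) : lev ((hubV k z L : slab111 k) : Site 3) = L :=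
  lev_hubV D.hz (D.hub_facts hL).1 (by have := (D.hub_facts hL).2.1; omega) (by have := (D.hub_facts hL).2.2.1; omega)

/-- The two hubs differ. [folklore] -/
theorem HA_ne_HD : D.HA ≠ D.HD :=
  hubV_ne D.hz D.hLA D.hLDc (by have := D.hLA1; omega) (by have := D.hLAk; omega) (by have := D.hLD1; omega) (by have := D.hLDk; omega)
    (by rcases D.hτ with h | h <;> have := D.hLD <;> omega)

/-- A vertex satisfying the hub condition is neither hub. [folklore] -/
theorem ne_hub_of_cond {v : slab111 k} (hv : sh v ≠ vcol z (0, 0) ∨ (lev (v : Site 3) ≠ D.LA ∧ lev (v : Site 3) ≠ D.LD)) {L : ℤ} (hL : D.IsHub L) :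
    v ≠ hubV k z L := by
  intro h
  rcases hv with hv | ⟨hvA, hvD⟩
  · exact hv (h ▸ D.sh_hub hL)
  · have := D.lev_hub hL
    rw [← h] at this
    rcases hL with rfl | rfl
    · exact hvA this
    · exact hvD this

/-! ### The `F1` segments -/

/-- End level of `S1`. [folklore] -/
theorem S1_end : D.ℓ₁ + D.τ * ((D.m₁ + 3 : ℕ) : ℤ) = D.LD + D.d₁ := by
  have hcast3 : ((D.m₁ + 3 : ℕ) : ℤ) = (D.m₁ : ℤ) + 3 := by push_cast; rfl
  rw [hcast3, D.hLD]
  have : D.ℓ₁ + D.τ * ((D.m₁ : ℤ) + 3) = (D.ℓ₁ + D.τ * (D.m₁ : ℤ)) + 3 * D.τ := by ring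
  rw [this, D.hm₁]; ring

/-- Range bounds of `S1`. [folklore] -/
theorem S1_bounds : 0 ≤ min D.ℓ₁ (D.ℓ₁ + D.τ * ((D.m₁ + 3 : ℕ) : ℤ)) ∧ max D.ℓ₁ (D.ℓ₁ + D.τ * ((D.m₁ + 3 : ℕ) : ℤ)) ≤ k ∧
    min D.ℓ₁ (min D.LA D.LD - 1) ≤ min D.ℓ₁ (D.ℓ₁ + D.τ * ((D.m₁ + 3 : ℕ) : ℤ)) ∧
    max D.ℓ₁ (D.ℓ₁ + D.τ * ((D.m₁ + 3 : ℕ) : ℤ)) ≤ max D.ℓ₁ (max D.LA D.LD + 1) := by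
  rw [D.S1_end]
  have := D.hℓ₁; have := D.hLD1; have := D.hLDk
  rcases D.hd1 with e | e <;> rw [e] <;> refine ⟨?_, ?_, ?_, ?_⟩ <;> omega

/-- `S1` is a path `e₁ → d`. [folklore] -/
theorem gS1 : GPath (film k) D.S1 D.e₁ D.d := by
  have := segL_gpath D.hz D.hF1 D.hτ D.S1_bounds.1 D.S1_bounds.2.1
  rw [D.S1_end] at this; exact this

/-- `S1 ⊆ PR`. [folklore] -/
theorem S1_PR : ∀ v ∈ D.S1, v ∈ PR :=
  segL_subset D.hτ fun L h1 h2 => D.hW1 L (le_trans D.S1_bounds.2.2.1 h1) (le_trans h2 D.S1_bounds.2.2.2)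

/-- A vertex `Clear` of `F1` over the window misses `S1`. [folklore] -/
theorem S1_clear {x : slab111 k} (hx : Clear z D.F1 (min D.ℓ₁ (min D.LA D.LD - 1)) (max D.ℓ₁ (max D.LA D.LD + 1)) x) : x ∉ D.S1 :=
  not_mem_segL_of_clear D.hz D.hF1 D.hτ D.S1_bounds.1 D.S1_bounds.2.1 D.S1_bounds.2.2.1 D.S1_bounds.2.2.2 hx

/-- Hubs miss `S1`. [folklore] -/
theorem hub_S1 {L : ℤ} (hL : D.IsHub L) : hubV k z L ∉ D.S1 :=
  hub_not_mem_segL D.hz D.hF1 D.ho1 (D.hub_facts hL).1 (by have := (D.hub_facts hL).2.1; omega) (by have := (D.hub_facts hL).2.2.1; omega)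
    D.hτ D.S1_bounds.1 D.S1_bounds.2.1

/-- Range bounds of `S1c`. [folklore] -/
theorem S1c_bounds : 0 ≤ min D.ℓ₁ (D.ℓ₁ + D.τ * (D.m₁ : ℤ)) ∧ max D.ℓ₁ (D.ℓ₁ + D.τ * (D.m₁ : ℤ)) ≤ k := by
  rw [D.hm₁]; have := D.hℓ₁; have := D.hLA1; have := D.hLAk
  rcases D.hd1 with e | e <;> rw [e] <;> constructor <;> omega

/-- `S1c` is a path `e₁ → c`. [folklore] -/
theorem gS1c : GPath (film k) D.S1c D.e₁ D.c := by
  have := segL_gpath D.hz D.hF1 D.hτ D.S1c_bounds.1 D.S1c_bounds.2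
  rw [D.hm₁] at this; exact this

/-- `S1c ⊆ S1`. [folklore] -/
theorem S1c_sub : ∀ v ∈ D.S1c, v ∈ D.S1 := by
  intro v hv
  obtain ⟨i, hi, rfl⟩ := mem_segL.1 hv
  exact mem_segL.2 ⟨i, by omega, rfl⟩

/-- Range bounds of `Syd`. [folklore] -/
theorem Syd_bounds : 0 ≤ min (D.LA + D.d₁ + D.τ) (D.LA + D.d₁ + D.τ + D.τ * ((2 : ℕ) : ℤ)) ∧
    max (D.LA + D.d₁ + D.τ) (D.LA + D.d₁ + D.τ + D.τ * ((2 : ℕ) : ℤ)) ≤ k := by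
  have hcast2 : ((2 : ℕ) : ℤ) = 2 := rfl
  rw [hcast2]
  have h1 := D.hLA1; have h2 := D.hLAk; have h3 := D.hLD1; have h4 := D.hLDk; have h5 := D.hLD
  rcases D.hd1 with e | e <;> rcases D.hτ with e' | e' <;> rw [e, e'] <;> rw [e'] at h5 <;> constructor <;> omega

/-- `Syd` is a path `y → d`. [folklore] -/
theorem gSyd : GPath (film k) D.Syd D.y D.d := by
  have := segL_gpath D.hz D.hF1 D.hτ D.Syd_bounds.1 D.Syd_bounds.2
  have e : D.LA + D.d₁ + D.τ + D.τ * ((2 : ℕ) : ℤ) = D.LD + D.d₁ := by push_cast; rw [D.hLD]; ring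
  rw [e] at this; exact this

/-- `Syd ⊆ S1`. [folklore] -/
theorem Syd_sub : ∀ v ∈ D.Syd, v ∈ D.S1 := by
  intro v hv
  obtain ⟨i, hi, rfl⟩ := mem_segL.1 hv
  refine mem_segL.2 ⟨D.m₁ + 1 + i, by omega, ?_⟩
  congr 1; push_cast; linear_combination -D.hm₁

/-- `S1c` and `Syd` are disjoint (levels on either side of `c`). [folklore] -/
theorem S1c_Syd : ∀ v ∈ D.S1c, v ∉ D.Syd := by
  intro v hv hv'
  have a := lev_of_mem_segL D.hz D.hF1 D.hτ D.S1c_bounds.1 D.S1c_bounds.2 hv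
  have b := lev_of_mem_segL D.hz D.hF1 D.hτ D.Syd_bounds.1 D.Syd_bounds.2 hv'
  rw [D.hm₁] at a
  have hcast2 : ((2 : ℕ) : ℤ) = 2 := rfl
  rw [hcast2] at b
  have hm := D.hm₁
  rcases D.hτ with e | e <;> rw [e] at b hm <;> omega

/-- The split of `S1` at `c, y`. [folklore] -/
theorem S1_split : ∃ l₁ l₂ : List (slab111 k), D.S1 = l₁ ++ D.c :: D.y :: l₂ := by
  obtain ⟨sl₁, sl₂, h⟩ := segL_split (k := k) z c0 D.F1 D.ℓ₁ D.τ (m := D.m₁) (n := D.m₁ + 3) (by omega)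
  refine ⟨sl₁, sl₂, ?_⟩
  rw [S1, h]
  have e2 : D.ℓ₁ + D.τ * ((D.m₁ : ℤ) + 1) = D.LA + D.d₁ + D.τ := by linear_combination D.hm₁
  rw [D.hm₁, e2]; rfl

/-- `c ∼ y`. [folklore] -/
theorem adj_c_y : (film k).Adj D.c D.y := by
  have := D.hLA1; have := D.hLAk; have := D.hLD1; have := D.hLDk; have hLD := D.hLD
  rcases D.hτ with e | e
  · rw [y, e]; exact adj_rideV D.hz D.hF1 (by rcases D.hd1 with e' | e' <;> rw [e'] <;> omega) (by rcases D.hd1 with e' | e' <;> rw [e'] <;> rw [e] at hLD <;> omega)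
  · have e1 : D.LA + D.d₁ + D.τ = D.LA + D.d₁ - 1 := by rw [e]; ring
    have e2 : D.LA + D.d₁ = D.LA + D.d₁ - 1 + 1 := by ring
    have h := adj_rideV (k := k) (z := z) (c0 := c0) (F := D.F1) D.hz D.hF1 (L := D.LA + D.d₁ - 1)
      (by rcases D.hd1 with e' | e' <;> rw [e'] <;> omega) (by rcases D.hd1 with e' | e' <;> rw [e'] <;> omega)
    rw [← e2, ← e1] at h
    exact h.symm

/-- `c, d, y ∈ S1`. [folklore] -/
theorem cdy_S1 : D.c ∈ D.S1 ∧ D.d ∈ D.S1 ∧ D.y ∈ D.S1 := ⟨D.S1c_sub _ D.gS1c.last_mem, D.gS1.last_mem, D.Syd_sub _ D.gSyd.head_mem⟩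

/-! ### The `F2` and `F3` segments -/

/-- Facts about `S2 L` for a hub level `L`: a path from the attachment to `e₂` inside `PR`, `Clear`-exclusion, hubs off it.
[folklore] -/
theorem S2_facts {L : ℤ} (hL : D.IsHub L) :
    GPath (film k) (D.S2 L) (rideV k z c0 D.F2 (L + D.d₂)) D.e₂ ∧ (∀ v ∈ D.S2 L, v ∈ PR) ∧
    (∀ x : slab111 k, Clear z D.F2 (min D.ℓ₂ (min D.LA D.LD - 1)) (max D.ℓ₂ (max D.LA D.LD + 1)) x → x ∉ D.S2 L) ∧
    (∀ {L' : ℤ}, D.IsHub L' → hubV k z L' ∉ D.S2 L) ∧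
    0 ≤ min (L + D.d₂) (L + D.d₂ + dirOf (L + D.d₂) D.ℓ₂ * (lenOf (L + D.d₂) D.ℓ₂ : ℤ)) ∧
    max (L + D.d₂) (L + D.d₂ + dirOf (L + D.d₂) D.ℓ₂ * (lenOf (L + D.d₂) D.ℓ₂ : ℤ)) ≤ k := by
  have hn := dir_len (L + D.d₂) D.ℓ₂
  have hσ := dirOf_eq (L + D.d₂) D.ℓ₂
  obtain ⟨-, h1, hk1, hlo, hhi⟩ := D.hub_facts hL
  have := D.hℓ₂
  have h0' : 0 ≤ min (L + D.d₂) (L + D.d₂ + dirOf (L + D.d₂) D.ℓ₂ * (lenOf (L + D.d₂) D.ℓ₂ : ℤ)) := by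
    rw [hn]; rcases D.hd2 with e | e <;> rw [e] <;> omega
  have hk' : max (L + D.d₂) (L + D.d₂ + dirOf (L + D.d₂) D.ℓ₂ * (lenOf (L + D.d₂) D.ℓ₂ : ℤ)) ≤ k := by
    rw [hn]; rcases D.hd2 with e | e <;> rw [e] <;> omega
  refine ⟨?_, ?_, ?_, ?_, h0', hk'⟩
  · have := segL_gpath D.hz D.hF2 hσ h0' hk'; rw [hn] at this; exact this
  · exact segL_subset hσ fun L'' ha hb => D.hW2 L'' (by rw [hn] at ha; rcases D.hd2 with e | e <;> rw [e] at ha <;> omega)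
      (by rw [hn] at hb; rcases D.hd2 with e | e <;> rw [e] at hb <;> omega)
  · intro x hx
    exact not_mem_segL_of_clear D.hz D.hF2 hσ h0' hk' (by rw [hn]; rcases D.hd2 with e | e <;> rw [e] <;> omega)
      (by rw [hn]; rcases D.hd2 with e | e <;> rw [e] <;> omega) hx
  · intro L' hL'
    obtain ⟨hc', h1', hk1', -, -⟩ := D.hub_facts hL'
    exact hub_not_mem_segL D.hz D.hF2 D.ho2 hc' (by omega) (by omega) hσ h0' hk'

/-- Facts about `S3 L` for a hub level `L`: a path from the attachment to `e₃` inside `W`, `Clear`-exclusion, hubs off it. [folklore] -/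
theorem S3_facts {L : ℤ} (hL : D.IsHub L) :
    GPath (film k) (D.S3 L) (rideV k z c0 D.F3 (L + D.d₃)) D.e₃ ∧ (∀ v ∈ D.S3 L, v ∈ W) ∧
    (∀ x : slab111 k, Clear z D.F3 (min D.ℓ₃ (min D.LA D.LD - 1)) (max D.ℓ₃ (max D.LA D.LD + 1)) x → x ∉ D.S3 L) ∧
    (∀ {L' : ℤ}, D.IsHub L' → hubV k z L' ∉ D.S3 L) ∧
    0 ≤ min (L + D.d₃) (L + D.d₃ + dirOf (L + D.d₃) D.ℓ₃ * (lenOf (L + D.d₃) D.ℓ₃ : ℤ)) ∧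
    max (L + D.d₃) (L + D.d₃ + dirOf (L + D.d₃) D.ℓ₃ * (lenOf (L + D.d₃) D.ℓ₃ : ℤ)) ≤ k := by
  have hn := dir_len (L + D.d₃) D.ℓ₃
  have hσ := dirOf_eq (L + D.d₃) D.ℓ₃
  obtain ⟨-, h1, hk1, hlo, hhi⟩ := D.hub_facts hL
  have := D.hℓ₃
  have h0' : 0 ≤ min (L + D.d₃) (L + D.d₃ + dirOf (L + D.d₃) D.ℓ₃ * (lenOf (L + D.d₃) D.ℓ₃ : ℤ)) := by
    rw [hn]; rcases D.hd3 with e | e <;> rw [e] <;> omega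
  have hk' : max (L + D.d₃) (L + D.d₃ + dirOf (L + D.d₃) D.ℓ₃ * (lenOf (L + D.d₃) D.ℓ₃ : ℤ)) ≤ k := by
    rw [hn]; rcases D.hd3 with e | e <;> rw [e] <;> omega
  refine ⟨?_, ?_, ?_, ?_, h0', hk'⟩
  · have := segL_gpath D.hz D.hF3 hσ h0' hk'; rw [hn] at this; exact this
  · exact segL_subset hσ fun L'' ha hb => D.hW3 L'' (by rw [hn] at ha; rcases D.hd3 with e | e <;> rw [e] at ha <;> omega)
      (by rw [hn] at hb; rcases D.hd3 with e | e <;> rw [e] at hb <;> omega)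
  · intro x hx
    exact not_mem_segL_of_clear D.hz D.hF3 hσ h0' hk' (by rw [hn]; rcases D.hd3 with e | e <;> rw [e] <;> omega)
      (by rw [hn]; rcases D.hd3 with e | e <;> rw [e] <;> omega) hx
  · intro L' hL'
    obtain ⟨hc', h1', hk1', -, -⟩ := D.hub_facts hL'
    exact hub_not_mem_segL D.hz D.hF3 D.ho3 hc' (by omega) (by omega) hσ h0' hk'

/-! ### Cross-face disjointness -/

/-- `S1` misses every `S2 L`. [folklore] -/
theorem S1_S2 {L : ℤ} (hL : D.IsHub L) : ∀ v ∈ D.S1, v ∉ D.S2 L := fun _ hv =>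
  not_mem_segL_of_disj D.hz D.hF1 D.hF2 D.h12 D.hτ D.S1_bounds.1 D.S1_bounds.2.1 (dirOf_eq _ _) (D.S2_facts hL).2.2.2.2.1
    (D.S2_facts hL).2.2.2.2.2 hv

/-- `S1` misses every `S3 L`. [folklore] -/
theorem S1_S3 {L : ℤ} (hL : D.IsHub L) : ∀ v ∈ D.S1, v ∉ D.S3 L := fun _ hv =>
  not_mem_segL_of_disj D.hz D.hF1 D.hF3 D.h13 D.hτ D.S1_bounds.1 D.S1_bounds.2.1 (dirOf_eq _ _) (D.S3_facts hL).2.2.2.2.1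
    (D.S3_facts hL).2.2.2.2.2 hv

/-- `S2 L` misses every `S3 L'`. [folklore] -/
theorem S2_S3 {L L' : ℤ} (hL : D.IsHub L) (hL' : D.IsHub L') : ∀ v ∈ D.S2 L, v ∉ D.S3 L' := fun _ hv =>
  not_mem_segL_of_disj D.hz D.hF2 D.hF3 D.h23 (dirOf_eq _ _) (D.S2_facts hL).2.2.2.2.1 (D.S2_facts hL).2.2.2.2.2 (dirOf_eq _ _)
    (D.S3_facts hL').2.2.2.2.1 (D.S3_facts hL').2.2.2.2.2 hv

end HubData

end Slab111

end Summit.CriticalPhenomena.PercolationContinuityZ3.Theorems.Transplant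

end
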